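import Summits.BirchSwinnertonDyer.Rank1Residual.X1.GeneratorCountLayerAtP
import Summits.BirchSwinnertonDyer.Rank1Residual.X1.GeneratorCountAnomalousTwo
import HarnessLib

/-!
# Route M's generator COUNT at LAYER `n`, VII: the relaxed-Kummer count with one extra place of
# ARBITRARY index `p^e` (cell `b2b-bsdres`, unit `b2b-bsdres-eisenstein-p1`, gen 19; X1R0-GAPMAP
# §28, memo `V76-LOCAL-TERM-PLAN.md` §4.5 route R1′)

HONEST FRAMING (run/shared/lean/b2b/bsd-rank1-residual/, verbatim in every file): the goal of the
cell is to DELETE the COMBINATION-SHAPED residual classes of the Birch–Swinnerton-Dyer formula for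
ALL analytic-rank `≤ 1` elliptic curves over `ℚ` — "full BSD formula for every rank `≤ 1` curve in
class `C`" assembled STRICTLY from published theorems — so that the rank-`≤ 1` remainder becomes
exactly the CONSTRUCTION-SHAPED classes, which are TYPED (missing-input `Prop`s), NOT attempted.
This is not "finishing BSD". Sub-cell `b2b-bsdres-eisenstein-p1` (CLASS-OWNERS row "X1 (r = 0)"):
research route; NO CLAIM BEYOND STATED CLASSES; nothing here changes a label; nothing is booked.
THEOREMS ONLY — no definition, no named fact, no typed input introduced; the local data at the extra
place (`𝓛`, its index `p^e`) and the published inputs (Poitou–Tate family, local Euler–Poincaré)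
are HYPOTHESES; nothing about any particular curve asserted.

## What and why

`exists_addSubgroup_relaxedKummer_at_pow` (any number field `K`): FILE 9 §1
(`X1/GeneratorCountLayerAtP.exists_addSubgroup_relaxedKummer_at`) with the index hypothesis at the
extra place `𝔭` generalised from `p · #𝓚_𝔭 ≤ #𝓛` to **`p^e · #𝓚_𝔭 ≤ #𝓛`** and the conclusion to
**`#S ≥ p^{#T₀ + e}`** (gen 15's per-place-exponent pair count
`GeneratorCountAnomalousTwo.finite_and_pow_le_card_selmerGroup_of_kummer_le_pow`). This is the shape
the local term `a = 2` of the 11 layer-1 classes needs (X1R0-GAPMAP §26.4, memo §4.10), and also the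
shape of the "relax to `⊤` at `𝔭`" count (`e = log_p [H¹ : 𝓚_𝔭]`). Consumer: the sequel
`X1/GeneratorCountLayerAtPStrict.lean` (route R1′ assembled over `ℚ_n`).

References: [GreenbergLNM1716] §3 Lemma 3.4, §5 pp. 114–118; [MilneADT2006] Ch. I Thm. 2.8,
Thm. 4.10; [DDT1997] Thm. 2.19; X1R0-GAPMAP §14.1, §26–§28.
-/

noncomputable section

open scoped Classical

open Function Field NumberField IsDedekindDomain WeierstrassCurve PowerSeries
  Literature.NumberTheory.EllipticCurves Literature.NumberTheory.GaloisRepresentations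
  Literature.NumberTheory.GaloisCohomology Summit.BirchSwinnertonDyer.Rank1Residual.GaloisImage
  Literature.NumberTheory.EllipticCurves.IwasawaAlgebra
  Summit.BirchSwinnertonDyer.Rank1Residual.Additive
  Summit.BirchSwinnertonDyer.Rank1Residual.Additive.ZpTower
  Summit.BirchSwinnertonDyer.Rank1Residual.X1.GeneratorBoundMuLayer
  Summit.BirchSwinnertonDyer.Rank1Residual.X1.GeneratorCountLayerTransport
open Literature.NumberTheory.GaloisRepresentations.DiscreteGaloisModule (SelmerStructure unramifiedSubgroup)

set_option autoImplicit false

namespace Summit.BirchSwinnertonDyer.Rank1Residual.X1.RelaxedKummerCountPow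

section Pow

variable {K : Type} [Field K] [NumberField K] {W : WeierstrassCurve K} [W.IsElliptic] {p : ℕ}
  [hp : Fact p.Prime]

/-- **The relaxed-Kummer count with one extra place of index `≥ p^e`.** `p` odd; `inv` a
Poitou–Tate family and `hEP` the local Euler–Poincaré formula over `K`; `T₀` finite places carrying
Tamagawa witnesses; `𝔭 ∉ T₀` an extra finite place with a local condition `𝓛 ⊇ 𝓚_𝔭` of index at
least `p^e` (`p^e·#𝓚_𝔭 ≤ #𝓛`). Then there is a FINITE subgroup `S ≤ H¹(K, E[p])` with
`#S ≥ p^{#T₀ + e}` whose classes are Kummer at every finite place off `T₀ ∪ {𝔭}` and at infinity,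
lie in `H¹_ur + 𝓚_v` at `v ∈ T₀`, and in `𝓛` at `𝔭`. FILE 9 §1 is the case `e = 1`.
[cite: GreenbergLNM1716, §5 pp. 114–118] [cite: MilneADT2006, Ch. I Thm. 2.8, Thm. 4.10] -/
theorem exists_addSubgroup_relaxedKummer_at_pow (hodd : p ≠ 2)
    (inv : LocalInvariants K p) (hperf : inv.IsPerfect) (hsum : inv.SumLocalTermEqZero)
    (hcompl : inv.SelmerComplement)
    (hEP : ∀ v : HeightOneSpectrum (𝓞 K), localEulerPoincareCharacteristic (v.adicCompletion K))
    (T₀ : Finset (HeightOneSpectrum (𝓞 K)))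
    (hwit : ∀ v ∈ T₀, ∃ u ∈ unramifiedSubgroup
        ((W.torsionGaloisModule (p : ℤ)).restrictField (v.adicCompletion K)) 1,
      u ∉ W.kummerLocalConditionAt (p : ℤ) (v.adicCompletion K))
    (vp : HeightOneSpectrum (𝓞 K)) (hvpT₀ : vp ∉ T₀)
    (𝓛 : ∀ v : HeightOneSpectrum (𝓞 K),
      AddSubgroup (galoisCohomology ((W.torsionGaloisModule (p : ℤ)).toLocal (Sum.inr v)) 1))
    (h𝓛 : W.kummerSelmerStructure (p : ℤ) (Sum.inr vp) ≤ 𝓛 vp) (e : ℕ)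
    (hidx : p ^ e * Nat.card (W.kummerSelmerStructure (p : ℤ) (Sum.inr vp)) ≤ Nat.card (𝓛 vp)) :
    ∃ S : AddSubgroup (galH1Torsion W (p : ℤ)), Finite S ∧ p ^ (T₀.card + e) ≤ Nat.card S ∧
      ∀ y ∈ S,
        (∀ v ∉ (↑(insert vp T₀) : Set (HeightOneSpectrum (𝓞 K))),
            y ∈ selmerLocalKer W (v.adicCompletion K) (p : ℤ)) ∧
        (∀ w : InfinitePlace K, y ∈ selmerLocalKer W w.Completion (p : ℤ)) ∧
        (∀ v ∈ T₀, galoisCohomology.res (W.torsionGaloisModule (p : ℤ)) (v.adicCompletion K) 1 y ∈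
          unramifiedSubgroup ((W.torsionGaloisModule (p : ℤ)).restrictField (v.adicCompletion K)) 1 ⊔
            W.kummerLocalConditionAt (p : ℤ) (v.adicCompletion K)) ∧
        galoisCohomology.localization (W.torsionGaloisModule (p : ℤ)) (Sum.inr vp) 1 y ∈ 𝓛 vp := by
  haveI : NeZero p := ⟨hp.out.ne_zero⟩
  haveI : Finite (geomTorsion W (p : ℤ)) := finite_geomTorsion_of_neZero W p
  -- a finite set `T ⊇ T₀ ∪ {vp} ∪ {bad} ∪ {v ∣ p}` of finite places
  have hbadfin : {v : HeightOneSpectrum (𝓞 K) | ¬ W.HasGoodReductionAt v}.Finite := by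
    have h := W.eventually_hasGoodReductionAt
    rwa [Filter.eventually_cofinite] at h
  have hp0 : (Ideal.span {((p : ℕ) : 𝓞 K)} : Ideal (𝓞 K)) ≠ 0 := by
    rw [Ne, Ideal.zero_eq_bot, Ideal.span_singleton_eq_bot]
    exact_mod_cast hp.out.ne_zero
  have hpfin : {v : HeightOneSpectrum (𝓞 K) | ((p : ℕ) : 𝓞 K) ∈ v.asIdeal}.Finite := by
    refine (Ideal.finite_factors hp0).subset fun v hv ↦ ?_
    exact (Ideal.dvd_span_singleton).mpr hv
  set T₁ : Finset (HeightOneSpectrum (𝓞 K)) := insert vp T₀ with hT₁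
  obtain ⟨T, hT₁T, hTp, hTbad⟩ : ∃ T : Finset (HeightOneSpectrum (𝓞 K)), T₁ ⊆ T ∧
      (∀ v, ((p : ℕ) : 𝓞 K) ∈ v.asIdeal → v ∈ T) ∧ ∀ v, ¬ W.HasGoodReductionAt v → v ∈ T :=
    ⟨T₁ ∪ (hbadfin.toFinset ∪ hpfin.toFinset), Finset.subset_union_left,
      fun v hv ↦ Finset.mem_union_right _ (Finset.mem_union_right _ (hpfin.mem_toFinset.mpr hv)),
      fun v hv ↦ Finset.mem_union_right _ (Finset.mem_union_left _ (hbadfin.mem_toFinset.mpr hv))⟩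
  have hS : ∀ v ∉ T, ((p : ℕ) : 𝓞 K) ∉ v.asIdeal ∧
      GaloisRep.IsUnramifiedAt v (W.torsionGaloisModule (p : ℤ)) := fun v hv ↦ by
    have hpv : ((p : ℕ) : 𝓞 K) ∉ v.asIdeal := fun h ↦ hv (hTp v h)
    have hgood : W.HasGoodReductionAt v := by_contra fun h ↦ hv (hTbad v h)
    exact ⟨hpv, X11b.AcSelmer.isUnramifiedAt_torsionGaloisModule W hgood
      (by rw [Int.cast_natCast]; exact hpv)⟩
  have hfs_p : ∀ v : HeightOneSpectrum (𝓞 K), ((p : ℕ) : 𝓞 K) ∈ v.asIdeal →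
      (Sum.inr v : Place K) ∈ finSupport T := fun v hv ↦ (inr_mem_finSupport_iff T v).mpr (hTp v hv)
  have hfs_bad : ∀ v : HeightOneSpectrum (𝓞 K), ¬ W.HasGoodReductionAt v →
      (Sum.inr v : Place K) ∈ finSupport T := fun v hv ↦ (inr_mem_finSupport_iff T v).mpr (hTbad v hv)
  have h𝓚 : (W.kummerSelmerStructure (p : ℤ)).IsUnramifiedOutside (finSupport T) := by
    have h1 := X11b.KummerDuality.kummerSelmerStructure_isUnramifiedOutside W p 1
      (finSupport T) (inl_mem_finSupport T) hfs_p hfs_bad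
    rwa [pow_one] at h1
  -- the relaxed structure `𝓖`: `𝓛` at `vp`, `H¹_ur + 𝓚_v` on `T₀`, `𝓚_v` elsewhere
  obtain ⟨𝓖, h𝓖inl, h𝓖vp, h𝓖T₀, h𝓖off⟩ : ∃ 𝓖 : SelmerStructure (W.torsionGaloisModule (p : ℤ)),
      (∀ w : InfinitePlace K, 𝓖 (Sum.inl w) = W.kummerSelmerStructure (p : ℤ) (Sum.inl w)) ∧
      𝓖 (Sum.inr vp) = 𝓛 vp ∧
      (∀ v ∈ T₀, 𝓖 (Sum.inr v) =
        unramifiedSubgroup (GaloisRep.toLocal v (W.torsionGaloisModule (p : ℤ))) 1 ⊔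
          W.kummerSelmerStructure (p : ℤ) (Sum.inr v)) ∧
      (∀ v ∉ T₁, 𝓖 (Sum.inr v) = W.kummerSelmerStructure (p : ℤ) (Sum.inr v)) := by
    refine ⟨fun w ↦ match w with
      | Sum.inl w => W.kummerSelmerStructure (p : ℤ) (Sum.inl w)
      | Sum.inr v => if v = vp then 𝓛 v else if v ∈ T₀ then
          unramifiedSubgroup (GaloisRep.toLocal v (W.torsionGaloisModule (p : ℤ))) 1 ⊔
            W.kummerSelmerStructure (p : ℤ) (Sum.inr v)
        else W.kummerSelmerStructure (p : ℤ) (Sum.inr v),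
      fun _ ↦ rfl, if_pos rfl, fun v hv ↦ ?_, fun v hv ↦ ?_⟩
    · have hne : v ≠ vp := fun h ↦ hvpT₀ (h ▸ hv)
      exact (if_neg hne).trans (if_pos hv)
    · have hne : v ≠ vp := fun h ↦ hv (h ▸ Finset.mem_insert_self vp T₀)
      have hv' : v ∉ T₀ := fun h ↦ hv (Finset.mem_insert_of_mem h)
      exact (if_neg hne).trans (if_neg hv')
  have hle : W.kummerSelmerStructure (p : ℤ) ≤ 𝓖 := by
    rintro (w | v)
    · rw [h𝓖inl w]
    · by_cases hv : v = vp
      · subst hv; rw [h𝓖vp]; exact h𝓛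
      by_cases hv' : v ∈ T₀
      · rw [h𝓖T₀ v hv']; exact le_sup_right
      · rw [h𝓖off v (by rw [Finset.mem_insert, not_or]; exact ⟨hv, hv'⟩)]
  have h𝓖ur : 𝓖.IsUnramifiedOutside (finSupport T) := by
    refine ⟨inl_mem_finSupport T, fun v hv ↦ ?_⟩
    have hvT : v ∉ T := fun h ↦ hv ((inr_mem_finSupport_iff T v).mpr h)
    rw [h𝓖off v fun h ↦ hvT (hT₁T h)]
    exact h𝓚.2 v hv
  -- exponents: `e` at `vp`, `1` on `T₀`
  have hbig : ∀ v ∈ T₁, p ^ (if v = vp then e else 1) *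
      Nat.card (W.kummerSelmerStructure (p : ℤ) (Sum.inr v)) ≤ Nat.card (𝓖 (Sum.inr v)) := by
    intro v hv
    rcases Finset.mem_insert.mp hv with rfl | hv
    · rw [if_pos rfl, h𝓖vp]; exact hidx
    · have hne : v ≠ vp := fun h ↦ hvpT₀ (h ▸ hv)
      rw [if_neg hne, pow_one]
      haveI := finite_galoisCohomology_one_toLocal (W.torsionGaloisModule (p : ℤ)) v
      obtain ⟨u, hu, huK⟩ := hwit v hv
      refine Additive.mul_card_le_card_of_lt
        (Additive.smul_galoisCohomology_toLocal_torsion_eq_zero W p v) ?_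
      rw [h𝓖T₀ v hv]
      exact right_lt_sup.mpr fun h ↦ huK (h hu)
  obtain ⟨hfin, hcard⟩ :=
    GeneratorCountAnomalousTwo.finite_and_pow_le_card_selmerGroup_of_kummer_le_pow W p hodd inv
      hperf hsum hcompl hEP T hS h𝓚 hle h𝓖ur (fun w ↦ (h𝓖inl w).symm) T₁ hT₁T _ hbig
  have hsumT₁ : ∑ v ∈ T₁, (if v = vp then e else 1) = T₀.card + e := by
    rw [hT₁, Finset.sum_insert hvpT₀, if_pos rfl, Finset.sum_congr rfl fun v hv ↦
      if_neg (fun h : v = vp ↦ hvpT₀ (h ▸ hv)), Finset.sum_const, smul_eq_mul, mul_one, add_comm]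
  rw [hsumT₁] at hcard
  refine ⟨𝓖.selmerGroup, hfin, hcard, fun y hy ↦ ⟨fun v hv ↦ ?_, fun w ↦ ?_, fun v hv ↦ ?_, ?_⟩⟩
  · have hv' : v ∉ T₁ := by rwa [hT₁, ← Finset.mem_coe]
    have h := (𝓖.mem_selmerGroup_iff y).mp hy (Sum.inr v)
    rw [h𝓖off v hv'] at h
    have h' : y ∈ (W.kummerSelmerStructure (p : ℤ) (Sum.inr v)).comap
        (galoisCohomology.localization (W.torsionGaloisModule (p : ℤ)) (Sum.inr v) 1) := h
    rw [comap_localization_kummerSelmerStructure] at h'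
    exact h'
  · have h := (𝓖.mem_selmerGroup_iff y).mp hy (Sum.inl w)
    rw [h𝓖inl w] at h
    have h' : y ∈ (W.kummerSelmerStructure (p : ℤ) (Sum.inl w)).comap
        (galoisCohomology.localization (W.torsionGaloisModule (p : ℤ)) (Sum.inl w) 1) := h
    rw [comap_localization_kummerSelmerStructure] at h'
    exact h'
  · have h := (𝓖.mem_selmerGroup_iff y).mp hy (Sum.inr v)
    rw [h𝓖T₀ v hv] at h
    exact h
  · have h := (𝓖.mem_selmerGroup_iff y).mp hy (Sum.inr vp)
    rw [h𝓖vp] at h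
    exact h

end Pow

end Summit.BirchSwinnertonDyer.Rank1Residual.X1.RelaxedKummerCountPow

end
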